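import Summits.ResolutionOfSingularities.ResolutionOfSingularities.Theorems.DeltaCutStellarJetStar

/-!
# StellarCut L20a — «LatentCut»: the ARTIN–SCHREIER (latent-contact) hypersurface shape `ncHypShapeLat`, its terminal
# hand-off to the coprime shape, the permissibility of the latent hop and the disjointness of the two strict transforms
# (lens-6 «barrier-complement carving», g36; engine of the cell `WORNCHypWildLat` carved out of `WORNCHypWildRest2`)

The binomial classes of T17a/T18/T19 present the stalk ideal along the contact hypersurface `V(H)` as `(hᵖ + u·m)`, `m` a frame
MONOMIAL.  Hauser's kangaroo `x² + (1+x)z²w²` (char `2`) is binomial for `h = x` with labels `(2, 2)` — a `2`-divisible closed point,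
no jet datum (T19d) — but for the COMPLETED SQUARE `h := x + zw` it reads `h² + (h + zw)·(zw)·(zw)`: an **Artin–Schreier stage**
`𝓘_y = (hᵖ + v·(h − c·m_μ)·m_b·m_μ^{p−1})`, `c, v` units, `m_b = 𝓜(E)_y`, `m_μ = 𝓜(L)_y` TWO frame monomials on the same boundary
(Cossart–Piltant's form `Xᵖ − g^{p−1}X + f` with monomial coefficients).  The list `E` carries the TERMINAL labels `b` (required `0`
or prime to `p` along their divisors, T18's clause verbatim), the list `L` the LATENT labels `μ`; `μ = 0` along `V(H)` is the
binomial coprime shape `ncHypShapeCop` (`h − c·m_μ` is then a unit).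

* §Shape — `ncHypShapeLat p X E L H M` and its API; the LATENT MASS `latMass L H = Σ_{q ∈ L, V(q.1) ∩ V(H) ≠ ∅} q.2`.
* §Terminal — `ncHypShapeLat.toCop`: latent mass `0` ⇒ `ncHypShapeCop p X E H M` (T18's class; its list law then applies by name).
* §Hop — for a member `K` with `expOf L K ≥ 1`: the codimension-`2` face `{H, K}` lies in `supp M` (`ncHypShapeLat.support_pair_subset`),
  and after its blow-up the strict transforms of `H` and `K` are DISJOINT (`not_mem_support_strict_pair`).

0 sorry; axioms standard. [new] [cite: CossartPiltant2008, Prop. 4.2] [cite: Hauser2010, §5] [cite: Kollar2007, (3.111) Step 3]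
-/
noncomputable section

open CategoryTheory CategoryTheory.Limits AlgebraicGeometry TopologicalSpace IsLocalRing
open Literature.AlgebraicGeometry.Resolution

namespace Summit.ResolutionOfSingularities.ResolutionOfSingularities.Theorems.DeltaCutClasses

open Summit.ResolutionOfSingularities.ResolutionOfSingularities.Theorems
open WeakOrderReduction ForcedTowerClasses

/-! ### §Shape — the Artin–Schreier (latent-contact) shape -/

section Shape

variable {X : Scheme.{0}}

/-- **THE ARTIN–SCHREIER / LATENT-CONTACT SHAPE `ncHypShapeLat p X E L H M`.**  Marking `p`; the `H`-entries of `E` and of `L`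
carry the label `0` (or `V(H) = ∅`); `L` and `E` label the same boundary; at every `x ∈ V(H)` the stalk ideal is
`(hᵖ + v·(h − c·m_μ)·m_b·m_μ^{p−1})` with `c, v` units, `(h) = H_x`, `(m_b) = 𝓜(E)_x`, `(m_μ) = 𝓜(L)_x`; `supp M ⊆ V(H)`; `p` is prime
and vanishes in every stalk; the `E`-exponent of every ideal sheaf `K` is `0` or prime to `p` along `V(K)` (T18's clause).
DEFINITION (the «LatentCut» class, list level). [new] [cite: CossartPiltant2008, Prop. 4.2] -/
def ncHypShapeLat (p : ℕ) (X : Scheme.{0}) (E L : List (X.IdealSheafData × ℕ)) (H : X.IdealSheafData) (M : MarkedIdeal X) :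
    Prop :=
  M.mult = p ∧ (∀ q ∈ E, q.1 = H → q.2 = 0 ∨ (H.support : Set X) = ∅) ∧ (∀ q ∈ L, q.1 = H → q.2 = 0 ∨ (H.support : Set X) = ∅) ∧
    boundaryOf L = boundaryOf E ∧
    (∀ x : X, x ∈ H.support → ∃ h mb mμ c v : X.presheaf.stalk x, IsUnit c ∧ IsUnit v ∧ stalkIdeal H x = Ideal.span {h} ∧
      stalkIdeal (monomialIdeal E) x = Ideal.span {mb} ∧ stalkIdeal (monomialIdeal L) x = Ideal.span {mμ} ∧
      stalkIdeal M.ideal x = Ideal.span {h ^ p + v * (h - c * mμ) * mb * mμ ^ (p - 1)}) ∧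
    M.support ⊆ (H.support : Set X) ∧ p.Prime ∧ (∀ x : X, ((p : ℕ) : X.presheaf.stalk x) = 0) ∧
    ∀ (K : X.IdealSheafData) (y : X), y ∈ K.support → expOf E K = 0 ∨ ¬ p ∣ expOf E K

open Classical in
/-- **THE LATENT MASS** of the latent label list `L` along `H`: the sum of the labels of the entries whose divisor MEETS `V(H)`.
The latent hops decrease it; at mass `0` the shape is T18's coprime shape. DEFINITION (termination measure). [new] -/
def latMass (L : List (X.IdealSheafData × ℕ)) (H : X.IdealSheafData) : ℕ :=
  (L.map fun q => if ((q.1.support : Set X) ∩ H.support).Nonempty then q.2 else 0).sum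

open Classical in
/-- a term of the latent mass is bounded by the mass -/
theorem term_le_latMass {L : List (X.IdealSheafData × ℕ)} {H : X.IdealSheafData} {q : X.IdealSheafData × ℕ} (hq : q ∈ L) :
    (if ((q.1.support : Set X) ∩ H.support).Nonempty then q.2 else 0) ≤ latMass L H :=
  List.single_le_sum (fun _ _ => Nat.zero_le _) _ (List.mem_map.mpr ⟨q, hq, rfl⟩)

/-- at latent mass `0`, an entry of `L` whose divisor meets `V(H)` has label `0` -/
theorem label_eq_zero_of_latMass_eq_zero {L : List (X.IdealSheafData × ℕ)} {H : X.IdealSheafData} (h0 : latMass L H = 0)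
    {q : X.IdealSheafData × ℕ} (hq : q ∈ L) (hne : ((q.1.support : Set X) ∩ H.support).Nonempty) : q.2 = 0 := by
  classical
  have h := term_le_latMass (H := H) hq
  rw [if_pos hne, h0] at h
  exact Nat.eq_zero_of_le_zero h

variable {E L : List (X.IdealSheafData × ℕ)} {H K : X.IdealSheafData} {p : ℕ} {M : MarkedIdeal X}

namespace ncHypShapeLat

/-- the marking is `p` -/
theorem mult_eq (hP : ncHypShapeLat p X E L H M) : M.mult = p := hP.1

/-- the `H`-entries of `E` carry the label `0` (or `V(H) = ∅`) -/
theorem labelE (hP : ncHypShapeLat p X E L H M) {q : X.IdealSheafData × ℕ} (hq : q ∈ E) (hqH : q.1 = H) :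
    q.2 = 0 ∨ (H.support : Set X) = ∅ := hP.2.1 q hq hqH

/-- the `H`-entries of `L` carry the label `0` (or `V(H) = ∅`) -/
theorem labelL (hP : ncHypShapeLat p X E L H M) {q : X.IdealSheafData × ℕ} (hq : q ∈ L) (hqH : q.1 = H) :
    q.2 = 0 ∨ (H.support : Set X) = ∅ := hP.2.2.1 q hq hqH

/-- the two label lists have the same boundary -/
theorem boundaryOf_eq (hP : ncHypShapeLat p X E L H M) : boundaryOf L = boundaryOf E := hP.2.2.2.1

/-- the Artin–Schreier presentation at a point of `V(H)` -/
theorem exists_generator (hP : ncHypShapeLat p X E L H M) {x : X} (hx : x ∈ H.support) :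
    ∃ h mb mμ c v : X.presheaf.stalk x, IsUnit c ∧ IsUnit v ∧ stalkIdeal H x = Ideal.span {h} ∧
      stalkIdeal (monomialIdeal E) x = Ideal.span {mb} ∧ stalkIdeal (monomialIdeal L) x = Ideal.span {mμ} ∧
      stalkIdeal M.ideal x = Ideal.span {h ^ p + v * (h - c * mμ) * mb * mμ ^ (p - 1)} :=
  hP.2.2.2.2.1 x hx

/-- `supp(M) ⊆ V(H)` -/
theorem support_subset (hP : ncHypShapeLat p X E L H M) : M.support ⊆ (H.support : Set X) := hP.2.2.2.2.2.1

/-- `p` is prime -/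
theorem prime (hP : ncHypShapeLat p X E L H M) : p.Prime := hP.2.2.2.2.2.2.1

/-- `p = 0` in every stalk -/
theorem cast_eq_zero (hP : ncHypShapeLat p X E L H M) (x : X) : ((p : ℕ) : X.presheaf.stalk x) = 0 := hP.2.2.2.2.2.2.2.1 x

/-- the terminal (`E`-) exponents are `0` or prime to `p` along their divisors -/
theorem labels (hP : ncHypShapeLat p X E L H M) {K : X.IdealSheafData} {y : X} (hy : y ∈ K.support) :
    expOf E K = 0 ∨ ¬ p ∣ expOf E K := hP.2.2.2.2.2.2.2.2 K y hy

/-- `expOf E H = 0` as soon as `V(H)` has a point -/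
theorem expOfE_eq_zero (hP : ncHypShapeLat p X E L H M) {y : X} (hy : y ∈ H.support) : expOf E H = 0 :=
  expOf_eq_zero_of_labels fun _ hq hqH => (hP.labelE hq hqH).resolve_right (Set.nonempty_iff_ne_empty.mp ⟨y, hy⟩)

/-- `expOf L H = 0` as soon as `V(H)` has a point -/
theorem expOfL_eq_zero (hP : ncHypShapeLat p X E L H M) {y : X} (hy : y ∈ H.support) : expOf L H = 0 :=
  expOf_eq_zero_of_labels fun _ hq hqH => (hP.labelL hq hqH).resolve_right (Set.nonempty_iff_ne_empty.mp ⟨y, hy⟩)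

end ncHypShapeLat

/-! ### §Terminal — latent mass zero is the coprime shape -/

/-- **at latent mass `0`, `𝓜(L)` is trivial along `V(H)`**: every entry of `L` through a point of `V(H)` is labelled `0`. [new] -/
theorem stalkIdeal_monomialIdeal_eq_top_of_latMass_eq_zero (h0 : latMass L H = 0) {x : X} (hx : x ∈ H.support) :
    stalkIdeal (monomialIdeal L) x = ⊤ := by
  rw [stalkIdeal_monomialIdeal, ← Ideal.one_eq_top]
  refine List.prod_eq_one fun I hI => ?_
  obtain ⟨q, hq, rfl⟩ := List.mem_map.mp hI
  by_cases hxq : x ∈ q.1.support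
  · rw [label_eq_zero_of_latMass_eq_zero h0 hq ⟨x, hxq, hx⟩, pow_zero]
  · rw [stalkIdeal_eq_top_of_not_mem_support hxq, ← Ideal.one_eq_top, one_pow]

/-- ★ **TERMINAL HAND-OFF**: an Artin–Schreier datum of latent mass `0` is a COPRIME datum (T18's `ncHypShapeCop`): along `V(H)` the
latent monomial `m_μ` is a unit, hence so is `h − c·m_μ` (`h ∈ 𝔪`), and `𝓘 = (hᵖ + u·m_b)` with the unit `u = v·(h − c·m_μ)·m_μ^{p−1}`.
[new] -/
theorem ncHypShapeLat.toCop (hP : ncHypShapeLat p X E L H M) (h0 : latMass L H = 0) : ncHypShapeCop p X E H M := by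
  refine ⟨⟨hP.mult_eq, fun _ hq hqH => hP.labelE hq hqH, fun x hx => ?_, hP.support_subset⟩, hP.prime, hP.cast_eq_zero,
    fun K y hy => hP.labels hy⟩
  obtain ⟨h, mb, mμ, c, v, hc, hv, hHx, hbx, hμx, hIx⟩ := hP.exists_generator hx
  have hunit : IsUnit mμ := by
    have htop := stalkIdeal_monomialIdeal_eq_top_of_latMass_eq_zero h0 hx
    rw [hμx, Ideal.span_singleton_eq_top] at htop
    exact htop
  have hh : h ∈ maximalIdeal _ := mem_maximalIdeal_of_stalkIdeal_eq_span hx hHx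
  have hl : IsUnit (h - c * mμ) := by
    by_contra hnu
    have hmem : h - c * mμ ∈ maximalIdeal _ := (mem_maximalIdeal _).mpr (mem_nonunits_iff.mpr hnu)
    have hcm : c * mμ ∈ maximalIdeal _ := by
      have h1 := Ideal.sub_mem _ hh hmem
      rwa [sub_sub_cancel] at h1
    exact (mem_nonunits_iff.mp ((mem_maximalIdeal _).mp hcm)) (hc.mul hunit)
  refine ⟨h, mb, v * (h - c * mμ) * mμ ^ (p - 1), (hv.mul hl).mul (hunit.pow _), hHx, hbx, ?_⟩
  rw [hIx, show h ^ p + v * (h - c * mμ) * mb * mμ ^ (p - 1) = h ^ p + v * (h - c * mμ) * mμ ^ (p - 1) * mb by ring]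

/-! ### §Hop — the codimension-two latent face `{H, K}`: frame membership, permissibility, disjointness -/

/-- **the codimension-two LATENT FACE `{H, K}`** (a `Finset`, classical decidability baked in). DEFINITION. [folklore] -/
def pairFace (H K : X.IdealSheafData) : Finset X.IdealSheafData := by classical exact {H, K}

/-- membership in the latent face -/
theorem mem_pairFace {K' : X.IdealSheafData} : K' ∈ pairFace H K ↔ K' = H ∨ K' = K := by
  classical
  simp only [pairFace, Finset.mem_insert, Finset.mem_singleton]

/-- `H ∈ {H, K}` -/
theorem left_mem_pairFace : H ∈ pairFace H K := mem_pairFace.mpr (Or.inl rfl)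

/-- `K ∈ {H, K}` -/
theorem right_mem_pairFace : K ∈ pairFace H K := mem_pairFace.mpr (Or.inr rfl)

/-- `{H, K} = insert H {K}` -/
theorem pairFace_eq_insert [DecidableEq X.IdealSheafData] : pairFace H K = insert H {K} := by
  ext K'
  rw [mem_pairFace, Finset.mem_insert, Finset.mem_singleton]

/-- the face `{H, K}` of a boundary member `K` lies in the frame `H :: boundaryOf E` -/
theorem pair_subset_frame (hK : K ∈ boundaryOf E) : ∀ K' ∈ pairFace H K, K' ∈ H :: boundaryOf E := by
  intro K' hK'
  rcases mem_pairFace.mp hK' with rfl | rfl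
  · exact List.mem_cons_self
  · exact List.mem_cons_of_mem _ hK

/-- **a positive exponent puts the monomial stalk inside the divisor's stalk**: `expOf L K ≥ 1`, `y ∈ V(K)` ⇒ `𝓜(L)_y ⊆ 𝔪_y`. [folklore] -/
theorem stalkIdeal_monomialIdeal_le_maximalIdeal_of_expOf (hLK : 1 ≤ expOf L K) {y : X} (hy : y ∈ K.support) :
    stalkIdeal (monomialIdeal L) y ≤ maximalIdeal (X.presheaf.stalk y) := by
  classical
  -- an entry `(K, e)` of `L` with `e ≥ 1`
  obtain ⟨q, hq, hqK, hq1⟩ : ∃ q ∈ L, q.1 = K ∧ 1 ≤ q.2 := by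
    by_contra hno
    push Not at hno
    have h0 : expOf L K = 0 := by
      rw [expOf, weightOf]
      refine List.sum_eq_zero fun a ha => ?_
      obtain ⟨q, hq, rfl⟩ := List.mem_map.mp ha
      by_cases hqK : q.1 ∈ ({K} : Finset X.IdealSheafData)
      · rw [if_pos hqK]
        exact Nat.lt_one_iff.mp (hno q hq (Finset.mem_singleton.mp hqK))
      · rw [if_neg hqK]
    omega
  obtain ⟨s, t, rfl⟩ := List.append_of_mem hq
  rw [stalkIdeal_monomialIdeal, List.map_append, List.map_cons, List.prod_append, List.prod_cons]
  refine Ideal.mul_le_left.trans (Ideal.mul_le_right.trans ?_)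
  rw [hqK]
  exact (Ideal.pow_le_self (by omega)).trans ((mem_support_iff_stalkIdeal_le K y).mp hy)

/-- ★ **PERMISSIBILITY OF THE LATENT HOP**: for a member `K` with `expOf L K ≥ 1`, the face `V(H) ∩ V(K)` lies in `supp M`
(`h ∈ 𝔪`, `m_μ ∈ 𝔪` there, so `hᵖ + v(h − c m_μ)m_b m_μ^{p−1} ∈ 𝔪ᵖ`). [new] -/
theorem ncHypShapeLat.support_pair_subset (hP : ncHypShapeLat p X E L H M) (hLK : 1 ≤ expOf L K) :
    ((((pairFace H K).sup id).support : Set X)) ⊆ M.support := by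
  intro y hy
  have hyH : y ∈ H.support := (mem_support_finsetSup_iff _ y).mp hy H left_mem_pairFace
  have hyK : y ∈ K.support := (mem_support_finsetSup_iff _ y).mp hy K right_mem_pairFace
  obtain ⟨h, mb, mμ, c, v, -, -, hHx, -, hμx, hIx⟩ := hP.exists_generator hyH
  have hh : h ∈ maximalIdeal _ := mem_maximalIdeal_of_stalkIdeal_eq_span hyH hHx
  have hmμ : mμ ∈ maximalIdeal _ := by
    have hle := stalkIdeal_monomialIdeal_le_maximalIdeal_of_expOf hLK hyK
    rw [hμx, Ideal.span_singleton_le_iff_mem] at hle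
    exact hle
  have hp1 : 1 ≤ p := hP.prime.one_lt.le
  show y ∈ M.support
  rw [MarkedIdeal.mem_support_iff, hP.mult_eq, hIx, Ideal.span_singleton_le_iff_mem]
  refine Ideal.add_mem _ (Ideal.pow_mem_pow hh p) ?_
  have h1 : h - c * mμ ∈ maximalIdeal _ := Ideal.sub_mem _ hh (Ideal.mul_mem_left _ _ hmμ)
  have h2 := Ideal.mul_mem_mul h1 (Ideal.pow_mem_pow hmμ (p - 1))
  rw [← pow_succ', Nat.sub_add_cancel hp1] at h2
  rw [show v * (h - c * mμ) * mb * mμ ^ (p - 1) = (v * mb) * ((h - c * mμ) * mμ ^ (p - 1)) by ring]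
  exact Ideal.mul_mem_left _ _ h2

/-- a point of the support has a proper stalk ideal -/
theorem stalkIdeal_ne_top_of_mem_support {I : X.IdealSheafData} {x : X} (hx : x ∈ I.support) : stalkIdeal I x ≠ ⊤ := fun h =>
  (maximalIdeal.isMaximal _).ne_top (top_le_iff.mp (h ▸ (mem_support_iff_stalkIdeal_le I x).mp hx))

/-- ★ **DISJOINTNESS after the latent hop**: for the blow-up `π` of the codimension-`2` face `V(H) ∩ V(K)` (`H ≠ K` in the s.n.c.
frame), the strict transforms of `H` and `K` have NO common point (over the centre some member of the face has trivial strict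
transform; off the centre a common point would lie over the centre). [folklore] [cite: Kollar2007, (3.111) Step 3] -/
theorem not_mem_support_strict_pair [IsLocallyNoetherian X] {X' : Scheme.{0}} {π : X' ⟶ X} (hEs : HasSNC (H :: boundaryOf E))
    (hK : K ∈ boundaryOf E) (hπ : IsBlowup π ((pairFace H K).sup id)) {x' : X'}
    (hx' : x' ∈ (strictTransformIdeal π ((pairFace H K).sup id) H).support) :
    x' ∉ (strictTransformIdeal π ((pairFace H K).sup id) K).support := by
  intro hxK
  by_cases hxC : π x' ∈ (((pairFace H K).sup id)).support
  · obtain ⟨K₀, hK₀, htop⟩ := exists_stalkIdeal_strictTransformIdeal_eq_top hEs (pair_subset_frame hK) hπ hxC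
    rcases mem_pairFace.mp hK₀ with rfl | rfl
    · exact stalkIdeal_ne_top_of_mem_support hx' htop
    · exact stalkIdeal_ne_top_of_mem_support hxK htop
  · refine hxC ((mem_support_finsetSup_iff _ (π x')).mpr fun K' hK' => ?_)
    rcases mem_pairFace.mp hK' with rfl | rfl
    · exact mem_support_of_mem_support_strictTransformIdeal hx'
    · exact mem_support_of_mem_support_strictTransformIdeal hxK

end Shape

end Summit.ResolutionOfSingularities.ResolutionOfSingularities.Theorems.DeltaCutClasses

end
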